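import Summits.FinalStateConjecture.FinalStateConjecture.Theses.NoVacuumStrings
import Literature.Geometry.Lorentzian.SelfSimilarVacuumProfile

/-!
# Birth skeleton (BC3) for crux `LonelyTipTameExit` (stmt-FinalStateConjecture-17358),
# route `NoVacuumStrings` — "rank-0 census, then profile instability, then basin landing"

planner-skel-stmt-FinalStateConjecture-17358-0 (skeleton registrar, route re-audit bin REPAIRABLE),
2026-08-17. Target: the route decl
`Summit.FinalStateConjecture.FinalStateConjecture.Theses.NoVacuumStrings.LonelyTipTameExit`
BY NAME (rev 10 of the route file), concluded by `LonelyTipTameExit_of` from three named stubs.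

## The crux

LONELY TIP TAME EXIT (card K4 of no-vacuum-strings-symmetry-rank-census, the rank-0 handoff;
NoVacuumStrings r4): for every admissible datum `D`, maximal vacuum Cauchy development `𝒟` of `D`
and first naked point `P` of `𝒟` carrying a NON-FLAT `C²` singularity model `(𝓩, P₀)` centred
at a minimal TIP, IF every such model at every first naked point of every MGHD of `D` is LONELY
(no Killing flow of the model moves its tip: the conclusion of `LonelyNakedTips` specialised to
`D`), THEN through `D` passes — on ONE asymptotically flat end `e` — a tame, immersed, injective
curve `F` of admissible data (`F 0 = D`) whose members with `0 < ‖c‖ < ε` are GOOD in the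
re-typed summit's sense (an MGHD exists; every MGHD has complete `𝓘⁺` and a sub-extremal Kerr
final-state decomposition `d` of `O = exteriorOf 𝒟' d.charted` with `RaysStayInClosure`,
honest-radii `HasExhaustiveCharts`, `IsFutureOriented`).

## The line: census (rank 0 ⇒ self-similar) ∘ profile instability (naked ⇒ censored) ∘ landing

The route's own reading of this crux ("the loneliness hypothesis makes the self-similar census
of the tangent-profile programme without loss of generality (isolated, maximally asymmetric
tips); the exit itself is that programme's smooth-class instability + basin landing, along a
line of FIXED asymptotics") is cut into its three mathematically distinct contents, chained by
the landed kernel `InitialDataSet.exists_tameFamily_of_local` (TameGenericityLocal.lean,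
sorry-free: radial contraction of the parameter turns "members with `0 < ‖c‖ < ε`" into "all
members off `0`", same end, same base datum):

* `stub_selfSimilarCensusOfLonelyTips` (S1, the stub that CONSUMES the crux's two hypotheses) —
  THE RANK-0 CENSUS: at a first naked point `P` of an MGHD of admissible data which carries a
  non-flat `C²` model centred at a minimal TIP, if all models of the datum are lonely (symmetry
  rank 0: no string, sheet or loop of tips), then `𝒟` has at `P` a NONFLAT SMOOTH SELF-SIMILAR
  vacuum profile `Z` (`SelfSimilarVacuumProfile ⊤`, continuously OR discretely self-similar, `C^∞`
  across its past cone) as a `C²` tangent profile, marked past = the past of `Z`'s vertex. The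
  typed layer's version of "an isolated first singularity is asymptotically self-similar"
  (tangent-object uniqueness / Type-I concentration at an isolated singular point: White's
  stratification by translation-invariance of tangent objects, transplanted; RSR's self-similar
  extraction). It is where loneliness is load-bearing: translations (rank ≥ 1) are exactly what
  separates a general minimal-TIP model from the cone-with-vertex shape of a self-similar profile.
* `stub_profileCensoredExit` (S2) — SMOOTH-CLASS PROFILE INSTABILITY, exit into CENSORED data: a
  first naked point carrying a nonflat smooth self-similar `C²` tangent profile forces, on one
  end `e`, a tame immersed injective admissible curve through `D` whose members with
  `0 < ‖c‖ < ε` own an MGHD and are censored (every MGHD has complete `𝓘⁺`). Christodoulou's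
  instability of naked singularities, smooth class, along a line of fixed asymptotics; a literal
  weakening of the sibling crux `HomotheticSurfaceGravity.ProfileExit` (stmt-17352), whose
  conclusion is "good" rather than "censored".
* `stub_settlingAlongCensoredCurves` (S3) — BASIN LANDING, relative curve form with an ARBITRARY
  (here: naked) admissible base datum: given a tame immersed injective admissible curve `F` on `e`
  through `D` ALL of whose members off `0` are censored with MGHDs, there is one (same end,
  through `D`) whose small members are GOOD (complete `𝓘⁺`, sub-extremal Kerr decomposition of
  `O = exteriorOf` with `RaysStayInClosure`, `HasExhaustiveCharts`, `IsFutureOriented`).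
  Large-data asymptotic stability of the Kerr family + generic third law + the interior clause,
  produced along a censored curve whose base point is the naked datum itself (so NOT a consequence
  of the censored-base stubs of `Cruxes/TameCensoredDataExit/Lines/birth.lean`, whose finer split
  — settle (closed) / third law (open) / rays — is the foreseen layer below this stub).

`crux_body_of_stub_sigs : S1-sig → S2-sig → S3-sig → <body of the crux>` (sorry-free, below):
S1 at `(D, 𝒟, P)` with the crux's model and loneliness hypotheses; S2 at the profile; kernel;
S3 along the censored curve. `LonelyTipTameExit_of : <route decl> := crux_body_of_stub_sigs
stub_… stub_… stub_…` — the only theorem of the file whose conclusion is the crux BY NAME,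
hypothesis-free (A12 shape); the file's only `sorry`s are the three stubs.

Disproof used: no `Cruxes/LonelyTipTameExit/Disproof.lean`, no
`Theorems/LonelyTipTameExit/Negative/` exists (crux dir empty at registration: `ledger crux ls`
"no workfiles yet"); negatives index of the summit (2026-08-17): one unrelated entry
(UniformPhotonSphereChannels, stmt-10045). Grounder certificates on the item (Reduce17358.lean
etc., 2026-08-16): `TangentProfileCensorship.NakedDataTameExit → LonelyTipTameExit` with the
model/loneliness hypotheses UNUSED — this skeleton is the line on which they ARE used (S1), i.e.
the route's own bet that rank 0 makes the census cheaper than the unconditional NakedDataTameExit.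
-/

noncomputable section

-- D-0017: single-problem summit, `Summit.<S>.<S>.…` by design (cf. lakefile `weak.linter.dupNamespace`).
set_option linter.dupNamespace false

open Set Function Filter
open scoped Manifold ContDiff Topology

namespace Summit.FinalStateConjecture.FinalStateConjecture.Cruxes.LonelyTipTameExit.Birth

open Literature.Geometry.Lorentzian

/-! ## §1 The stubs -/

/-- **Stub 1 — the rank-0 census: lonely tips are self-similar.** For every admissible datum
`D`, maximal vacuum Cauchy development `𝒟` of `D` and first naked point `P` of `𝒟` such that
(a) `𝒟` has at `P` a `C²` tangent profile `(𝓩, P₀)` with `P₀` a MINIMAL TIP of `𝓩` and `𝓩`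
non-flat (the crux's model hypothesis, verbatim), and (b) every such model at every first naked
point of every MGHD of `D` is LONELY — every integral curve of every Killing field of the model
that starts in the marked past `P₀` stays in `P₀` (the crux's loneliness hypothesis = the
conclusion of `LonelyNakedTips` at `D`, verbatim) — there is a NONFLAT smooth self-similar vacuum
profile `Z` (`SelfSimilarVacuumProfile ⊤`: a discrete homothety `Φ^* g = e^{2Δ} g`, CSS being the
degenerate case; metric `C^∞` across the past cone of the vertex) which is a `C²` tangent profile
of `𝒟` at `P`, marked past = `Z.past` (the chronological past of `Z`'s vertex). Content: at an
ISOLATED first singular point (symmetry rank 0: no spacelike translation = string of tips, no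
sheet, no loop, no null/timelike translation) the blow-up is Type-I and asymptotically
(continuously or discretely) self-similar — the Lorentzian transplant of "tangent objects at
isolated singular points are cones" (White, J. reine angew. Math. 488 (1997),
doi:10.1515/crll.1997.488.1; Cheeger–Naber, doi:10.4007/annals.2015.182.3.5) and of
self-similar extraction (Rodnianski–Shlapentokh-Rothman 2018, Thm. 1.2), with Christodoulou's
picture that first singularities of generic-codimension are self-similar (CQG 16 (1999) A23).
Why it might fail: a lonely tip may still be Type-II (no self-similar rate; `P₀ ≠ 𝓩` is assumed
but rates are not), or self-similar only in a class ROUGHER than `C^∞` across the cone — every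
known vacuum naked-singularity profile is merely `C^{1,α}` across it (arXiv:1912.08478 Thm. 1;
arXiv:2204.09891), so the smooth class `⊤` may be void exactly where it is needed; uniqueness of
tangent profiles (independence of the subsequence) is open even in the Riemannian analogue.
Sources: RodnianskiShlapentokhrothman2018, RodnianskiShlapentokhRothman2023,
Christodoulou1999instability, MorganTian2007 (Def. 5.3/5.32), doi:10.1515/crll.1997.488.1,
arXiv:1912.08478, arXiv:2204.09891, arXiv:2412.09540. Open (the load-bearing use of loneliness). -/
theorem stub_selfSimilarCensusOfLonelyTips : ∀ (X : Type) [TopologicalSpace X] [ChartedSpace E3 X] [IsManifold (𝓡 3) ((⊤ : ℕ∞) : WithTop ℕ∞) X] [T2Space X] [SecondCountableTopology X] [ConnectedSpace X], ∀ D ∈ admissibleVacuumData X, ∀ 𝒟 : VacuumCauchyDevelopment D, 𝒟.IsMaximal → ∀ P : Set 𝒟.carrier, 𝒟.toCauchyDevelopment.FirstNakedPoint P → (∃ (𝓩 : Spacetime.{0} 4) (P₀ : Set 𝓩.carrier), Spacetime.IsTangentProfileAt 𝒟.toSpacetime P 𝓩 P₀ 2 ∧ 𝓩.metric.IsMinimalTIP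 𝓩.timeOrientation P₀ ∧ ∀ [𝓩.metric.HasLeviCivita], ¬ 𝓩.metric.leviCivita.IsFlat) → (∀ 𝒟₁ : VacuumCauchyDevelopment D, 𝒟₁.IsMaximal → ∀ P₁ : Set 𝒟₁.carrier, 𝒟₁.toCauchyDevelopment.FirstNakedPoint P₁ → ∀ (𝓩 : Spacetime.{0} 4) (P₀ : Set 𝓩.carrier), Spacetime.IsTangentProfileAt 𝒟₁.toSpacetime P₁ 𝓩 P₀ 2 → 𝓩.metric.IsMinimalTIP 𝓩.timeOrientation P₀ → ∀ [𝓩.metric.HasLeviCivita], ¬ 𝓩.metric.leviCivita.IsFlat → ∀ (K : Π x : 𝓩.carrier, TangentSpace (𝓡 4) x) (γ : ℝ → 𝓩.carrier) (t : ℝ), 𝓩.metric.IsKillingField K → IsMIntegralCurveOn γ K (Set.uIcc 0 t) → γ 0 ∈ P₀ → γ t ∈ P₀) → ∃ Z : SelfSimilarVacuumProfile.{0} ((⊤ : ℕ∞) : WithTop ℕ∞), Z.IsNonflat ∧ Spacetime.IsTangentProfileAt 𝒟.toSpacetime P Z.toSpacetime Z.past 2 := by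
  sorry

/-- **Stub 2 — smooth-class profile instability: exit from a self-similar naked point into
CENSORED data.** For every admissible datum `D`, maximal vacuum Cauchy development `𝒟` of `D`,
first naked point `P` of `𝒟` and NONFLAT smooth self-similar vacuum profile `Z` which is a `C²`
tangent profile of `𝒟` at `P` (marked past `Z.past`), there are ONE asymptotically flat end `e`
of `X`, a one-parameter family `F` of admissible data tame on `e` (`IsTameDataFamily e 1 F`),
immersed at `0` (`IsImmersedAtZero 1 F`), injective, with `F 0 = D`, and `ε > 0` such that for
`0 < ‖c‖ < ε` the datum `F c` owns an MGHD and every MGHD of `F c` has complete future null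
infinity (sojourn form). Content: Christodoulou's instability of naked singularities in the
smooth class (CQG 16 (1999) A23, p. A24: the exceptional set is met transversally by lines
`α₀ + c f` of FIXED asymptotics — here tame curves on one fixed end), driven by the unstable
smooth mode of the self-similar profile transported to the data (the tangent-profile programme:
`TangentProfileCensorship` informal items 9972/9974, `HomotheticSurfaceGravity.ProfileExit`
stmt-17352, of which this stub is a literal weakening — "censored" in place of "good"); finitely
many first naked points per datum so that one kick serves all. Why it might fail: self-similar
naked singularities can be STABLE at threshold regularity and under small smooth perturbations
of mild profiles (Zheng, arXiv:2605.16235 Thm. 1.3; arXiv:2605.16095); smooth-to-cone DSS naked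
exteriors with `μ ≪ 1` exist (arXiv:2412.09540); the kick must keep the Dafermos–Rodnianski rates
on ONE fixed end with continuous mass and be immersed at `0`, and a second naked point may be
born along the curve (no quantisation theorem). Sources: Christodoulou1999instability,
Christodoulou1999, RodnianskiShlapentokhRothman2023, arXiv:2605.16235, arXiv:2605.16095,
arXiv:2412.09540, An2025, LiLiu2022. Open. -/
theorem stub_profileCensoredExit : ∀ (X : Type) [TopologicalSpace X] [ChartedSpace E3 X] [IsManifold (𝓡 3) ((⊤ : ℕ∞) : WithTop ℕ∞) X] [T2Space X] [SecondCountableTopology X] [ConnectedSpace X], ∀ D ∈ admissibleVacuumData X, ∀ 𝒟 : VacuumCauchyDevelopment D, 𝒟.IsMaximal → ∀ P : Set 𝒟.carrier, 𝒟.toCauchyDevelopment.FirstNakedPoint P → ∀ Z : SelfSimilarVacuumProfile.{0} ((⊤ : ℕ∞) : WithTop ℕ∞), Z.IsNonflat → Spacetime.IsTangentProfileAt 𝒟.toSpacetime P Z.toSpacetime Z.past 2 → ∃ (e : AFEnd X) (F : EuclideanSpace ℝ (Fin 1) → InitialDataSet (𝓡 3) X), InitialDataSet.IsTameDataFamily e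 1 F ∧ InitialDataSet.IsImmersedAtZero 1 F ∧ F 0 = D ∧ Function.Injective F ∧ (∀ c, F c ∈ admissibleVacuumData X) ∧ ∃ ε : ℝ, 0 < ε ∧ ∀ c, c ≠ 0 → ‖c‖ < ε → ((∃ 𝒟' : VacuumCauchyDevelopment (F c), 𝒟'.IsMaximal) ∧ ∀ 𝒟' : VacuumCauchyDevelopment (F c), 𝒟'.IsMaximal → Summit.FinalStateConjecture.HasCompleteNullInfinity 𝒟'.toCauchyDevelopment) := by
  sorry

/-- **Stub 3 — basin landing along a censored curve (relative curve form, ARBITRARY admissible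
base datum).** Let `D` be an admissible datum (no hypothesis on its own developments: in the line
`D` is the NAKED datum of the crux) and let `F` be a one-parameter family of admissible data, tame
on the end `e`, immersed at `0`, injective, `F 0 = D`, ALL of whose members off `0` own an MGHD and
are censored. Then there is a family `F'` of admissible data, tame on the SAME end, immersed at
`0`, injective, `F' 0 = D`, and `ε > 0` such that for `0 < ‖c‖ < ε` the datum `F' c` is GOOD: it
owns an MGHD, and every MGHD of `F' c` has complete `𝓘⁺` and carries a final-state decomposition
`d` into finitely many boosted SUB-extremal Kerr black holes (`Kerr.IsSubextremal`) of its
self-determined exterior `O = exteriorOf 𝒟 d.charted`, with every future-complete normalised null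
ray from the data staying in `closure O` (`RaysStayInClosure`), honest growing near-zone radii
(`HasExhaustiveCharts`) and future-oriented chart time (`IsFutureOriented`). Content: the
final-state half of the conjecture RELATIVE to a given censored curve — large-data asymptotic
stability of the Kerr family for censored developments (Dafermos–Luk 2017 §1.2.1;
Klainerman–Szeftel 2023 for `|a| ≪ M`; Giorgi–Klainerman–Szeftel 2022;
Dafermos–Holzegel–Rodnianski–Taylor 2021), genericity of the third law (Kehle–Unger 2025:
extremal horizons form, as a threshold), and the interior clause (no future-complete null ray from
`Σ` strictly inside a hole settling to sub-extremal Kerr: Cauchy-horizon termination, Dafermos–Luk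
2017 Thm. 1), produced by RE-CHOOSING the curve through the same base point. Its foreseen finer
split is the censored-base chain settle (closed) → third law (open) → rays of
`Cruxes/TameCensoredDataExit/Lines/birth.lean`, which does NOT imply this stub (there the base
datum is censored; here it is the naked datum, approached along censored data). Why it might
fail: Kerr stability is printed only for `|a| ≪ M` (barrier `SlowlyRotatingKerrFrontier`); near a
NAKED base datum the censored members are near-critical, where non-settling / extremal /
many-hole end states may accumulate along every tame curve through `D` (Cantor-like threshold
lamination, cf. arXiv:0711.4612), leaving no re-chosen curve with good small members; honest
`C²`-exhaustive charts need Price-law decay down to the horizons. Sources: DafermosLuk2017,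
KlainermanSzeftel2023, GiorgiKlainermanSzeftel2022, DafermosHolzegelRodnianskiTaylor2021,
KehleUnger2025, AngelopoulosKehleUnger2024, arXiv:0711.4612, arXiv:0811.0354. Open. -/
theorem stub_settlingAlongCensoredCurves : ∀ (X : Type) [TopologicalSpace X] [ChartedSpace E3 X] [IsManifold (𝓡 3) ((⊤ : ℕ∞) : WithTop ℕ∞) X] [T2Space X] [SecondCountableTopology X] [ConnectedSpace X], ∀ D ∈ admissibleVacuumData X, ∀ (e : AFEnd X) (F : EuclideanSpace ℝ (Fin 1) → InitialDataSet (𝓡 3) X), InitialDataSet.IsTameDataFamily e 1 F → InitialDataSet.IsImmersedAtZero 1 F → F 0 = D → Function.Injective F → (∀ c, F c ∈ admissibleVacuumData X) → (∀ c, c ≠ 0 → ((∃ 𝒟 : VacuumCauchyDevelopment (F c), 𝒟.IsMaximal) ∧ ∀ 𝒟 : VacuumCauchyDevelopment (F c), 𝒟.IsMaximal → Summit.FinalStateConjecture.HasCompleteNullInfinity 𝒟.toCauchyDevelopment)) → ∃ F' : EuclideanSpace ℝ (Fin 1) → InitialDataSet (𝓡 3) X, InitialDataSet.IsTameDataFamily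 e 1 F' ∧ InitialDataSet.IsImmersedAtZero 1 F' ∧ F' 0 = D ∧ Function.Injective F' ∧ (∀ c, F' c ∈ admissibleVacuumData X) ∧ ∃ ε : ℝ, 0 < ε ∧ ∀ c, c ≠ 0 → ‖c‖ < ε → ((∃ 𝒟 : VacuumCauchyDevelopment (F' c), 𝒟.IsMaximal) ∧ ∀ 𝒟 : VacuumCauchyDevelopment (F' c), 𝒟.IsMaximal → Summit.FinalStateConjecture.HasCompleteNullInfinity 𝒟.toCauchyDevelopment ∧ ∃ (O : Set 𝒟.carrier) (d : FinalStateDecomposition 𝒟.toSpacetime O 2), (∀ i, Kerr.IsSubextremal (d.mass i) (d.spin i)) ∧ O = Summit.FinalStateConjecture.exteriorOf 𝒟.toCauchyDevelopment d.charted ∧ Summit.FinalStateConjecture.RaysStayInClosure 𝒟.toCauchyDevelopment O ∧ Summit.FinalStateConjecture.HasExhaustiveCharts d ∧ Summit.FinalStateConjecture.IsFutureOriented d) := by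
  sorry

/-! ## §2 The composition (sorry-free): stubs 1–3 ⟹ the route decl, by name -/

/-- **The three stub SIGNATURES imply the body of the crux** (hypotheses = the stub statements
verbatim, conclusion = the body of the route decl `LonelyTipTameExit` verbatim — stated on the
body so that exactly ONE theorem of this file, `LonelyTipTameExit_of`, concludes the crux by
name). Proof: S1 at `(D, 𝒟, P)` fed with the crux's model and loneliness hypotheses gives a
nonflat smooth self-similar `C²` tangent profile `Z`; S2 at `Z` gives a tame immersed injective
admissible curve through `D` whose small members are censored with an MGHD; the kernel
`InitialDataSet.exists_tameFamily_of_local` makes ALL members off `0` censored (same end, same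
base datum); S3 re-chooses the curve through `D` so that its small members are good. -/
theorem crux_body_of_stub_sigs :
    (∀ (X : Type) [TopologicalSpace X] [ChartedSpace E3 X] [IsManifold (𝓡 3) ((⊤ : ℕ∞) : WithTop ℕ∞) X] [T2Space X] [SecondCountableTopology X] [ConnectedSpace X], ∀ D ∈ admissibleVacuumData X, ∀ 𝒟 : VacuumCauchyDevelopment D, 𝒟.IsMaximal → ∀ P : Set 𝒟.carrier, 𝒟.toCauchyDevelopment.FirstNakedPoint P → (∃ (𝓩 : Spacetime.{0} 4) (P₀ : Set 𝓩.carrier), Spacetime.IsTangentProfileAt 𝒟.toSpacetime P 𝓩 P₀ 2 ∧ 𝓩.metric.IsMinimalTIP 𝓩.timeOrientation P₀ ∧ ∀ [𝓩.metric.HasLeviCivita], ¬ 𝓩.metric.leviCivita.IsFlat) → (∀ 𝒟₁ : VacuumCauchyDevelopment D, 𝒟₁.IsMaximal → ∀ P₁ : Set 𝒟₁.carrier, 𝒟₁.toCauchyDevelopment.FirstNakedPoint P₁ → ∀ (𝓩 : Spacetime.{0} 4) (P₀ : Set 𝓩.carrier), Spacetime.IsTangentProfileAt 𝒟₁.toSpacetime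 P₁ 𝓩 P₀ 2 → 𝓩.metric.IsMinimalTIP 𝓩.timeOrientation P₀ → ∀ [𝓩.metric.HasLeviCivita], ¬ 𝓩.metric.leviCivita.IsFlat → ∀ (K : Π x : 𝓩.carrier, TangentSpace (𝓡 4) x) (γ : ℝ → 𝓩.carrier) (t : ℝ), 𝓩.metric.IsKillingField K → IsMIntegralCurveOn γ K (Set.uIcc 0 t) → γ 0 ∈ P₀ → γ t ∈ P₀) → ∃ Z : SelfSimilarVacuumProfile.{0} ((⊤ : ℕ∞) : WithTop ℕ∞), Z.IsNonflat ∧ Spacetime.IsTangentProfileAt 𝒟.toSpacetime P Z.toSpacetime Z.past 2) →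
    (∀ (X : Type) [TopologicalSpace X] [ChartedSpace E3 X] [IsManifold (𝓡 3) ((⊤ : ℕ∞) : WithTop ℕ∞) X] [T2Space X] [SecondCountableTopology X] [ConnectedSpace X], ∀ D ∈ admissibleVacuumData X, ∀ 𝒟 : VacuumCauchyDevelopment D, 𝒟.IsMaximal → ∀ P : Set 𝒟.carrier, 𝒟.toCauchyDevelopment.FirstNakedPoint P → ∀ Z : SelfSimilarVacuumProfile.{0} ((⊤ : ℕ∞) : WithTop ℕ∞), Z.IsNonflat → Spacetime.IsTangentProfileAt 𝒟.toSpacetime P Z.toSpacetime Z.past 2 → ∃ (e : AFEnd X) (F : EuclideanSpace ℝ (Fin 1) → InitialDataSet (𝓡 3) X), InitialDataSet.IsTameDataFamily e 1 F ∧ InitialDataSet.IsImmersedAtZero 1 F ∧ F 0 = D ∧ Function.Injective F ∧ (∀ c, F c ∈ admissibleVacuumData X) ∧ ∃ ε : ℝ, 0 < ε ∧ ∀ c, c ≠ 0 → ‖c‖ < ε → ((∃ 𝒟' : VacuumCauchyDevelopment (F c), 𝒟'.IsMaximal) ∧ ∀ 𝒟' : VacuumCauchyDevelopment (F c), 𝒟'.IsMaximal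 → Summit.FinalStateConjecture.HasCompleteNullInfinity 𝒟'.toCauchyDevelopment)) →
    (∀ (X : Type) [TopologicalSpace X] [ChartedSpace E3 X] [IsManifold (𝓡 3) ((⊤ : ℕ∞) : WithTop ℕ∞) X] [T2Space X] [SecondCountableTopology X] [ConnectedSpace X], ∀ D ∈ admissibleVacuumData X, ∀ (e : AFEnd X) (F : EuclideanSpace ℝ (Fin 1) → InitialDataSet (𝓡 3) X), InitialDataSet.IsTameDataFamily e 1 F → InitialDataSet.IsImmersedAtZero 1 F → F 0 = D → Function.Injective F → (∀ c, F c ∈ admissibleVacuumData X) → (∀ c, c ≠ 0 → ((∃ 𝒟 : VacuumCauchyDevelopment (F c), 𝒟.IsMaximal) ∧ ∀ 𝒟 : VacuumCauchyDevelopment (F c), 𝒟.IsMaximal → Summit.FinalStateConjecture.HasCompleteNullInfinity 𝒟.toCauchyDevelopment)) → ∃ F' : EuclideanSpace ℝ (Fin 1) → InitialDataSet (𝓡 3) X, InitialDataSet.IsTameDataFamily e 1 F' ∧ InitialDataSet.IsImmersedAtZero 1 F' ∧ F' 0 = D ∧ Function.Injective F' ∧ (∀ c, F' c ∈ admissibleVacuumData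 X) ∧ ∃ ε : ℝ, 0 < ε ∧ ∀ c, c ≠ 0 → ‖c‖ < ε → ((∃ 𝒟 : VacuumCauchyDevelopment (F' c), 𝒟.IsMaximal) ∧ ∀ 𝒟 : VacuumCauchyDevelopment (F' c), 𝒟.IsMaximal → Summit.FinalStateConjecture.HasCompleteNullInfinity 𝒟.toCauchyDevelopment ∧ ∃ (O : Set 𝒟.carrier) (d : FinalStateDecomposition 𝒟.toSpacetime O 2), (∀ i, Kerr.IsSubextremal (d.mass i) (d.spin i)) ∧ O = Summit.FinalStateConjecture.exteriorOf 𝒟.toCauchyDevelopment d.charted ∧ Summit.FinalStateConjecture.RaysStayInClosure 𝒟.toCauchyDevelopment O ∧ Summit.FinalStateConjecture.HasExhaustiveCharts d ∧ Summit.FinalStateConjecture.IsFutureOriented d)) →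
    ∀ (X : Type) [TopologicalSpace X] [ChartedSpace Literature.Geometry.Lorentzian.E3 X] [IsManifold (𝓡 3) ((⊤ : ℕ∞) : WithTop ℕ∞) X] [T2Space X] [SecondCountableTopology X] [ConnectedSpace X], ∀ D ∈ Literature.Geometry.Lorentzian.admissibleVacuumData X, ∀ 𝒟 : Literature.Geometry.Lorentzian.VacuumCauchyDevelopment D, 𝒟.IsMaximal → ∀ P : Set 𝒟.carrier, 𝒟.toCauchyDevelopment.FirstNakedPoint P → (∃ (𝓩 : Literature.Geometry.Lorentzian.Spacetime.{0} 4) (P₀ : Set 𝓩.carrier), Literature.Geometry.Lorentzian.Spacetime.IsTangentProfileAt 𝒟.toSpacetime P 𝓩 P₀ 2 ∧ 𝓩.metric.IsMinimalTIP 𝓩.timeOrientation P₀ ∧ ∀ [𝓩.metric.HasLeviCivita], ¬ 𝓩.metric.leviCivita.IsFlat) → (∀ 𝒟₁ : Literature.Geometry.Lorentzian.VacuumCauchyDevelopment D, 𝒟₁.IsMaximal → ∀ P₁ : Set 𝒟₁.carrier, 𝒟₁.toCauchyDevelopment.FirstNakedPoint P₁ → ∀ (𝓩 : Literature.Geometry.Lorentzian.Spacetime.{0}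 4) (P₀ : Set 𝓩.carrier), Literature.Geometry.Lorentzian.Spacetime.IsTangentProfileAt 𝒟₁.toSpacetime P₁ 𝓩 P₀ 2 → 𝓩.metric.IsMinimalTIP 𝓩.timeOrientation P₀ → ∀ [𝓩.metric.HasLeviCivita], ¬ 𝓩.metric.leviCivita.IsFlat → ∀ (K : Π x : 𝓩.carrier, TangentSpace (𝓡 4) x) (γ : ℝ → 𝓩.carrier) (t : ℝ), 𝓩.metric.IsKillingField K → IsMIntegralCurveOn γ K (Set.uIcc 0 t) → γ 0 ∈ P₀ → γ t ∈ P₀) → ∃ (e : Literature.Geometry.Lorentzian.AFEnd X) (F : EuclideanSpace ℝ (Fin 1) → Literature.Geometry.Lorentzian.InitialDataSet (𝓡 3) X), Literature.Geometry.Lorentzian.InitialDataSet.IsTameDataFamily e 1 F ∧ Literature.Geometry.Lorentzian.InitialDataSet.IsImmersedAtZero 1 F ∧ F 0 = D ∧ Function.Injective F ∧ (∀ c, F c ∈ Literature.Geometry.Lorentzian.admissibleVacuumData X) ∧ ∃ ε : ℝ, 0 < ε ∧ ∀ c, c ≠ 0 → ‖c‖ < ε → ((∃ 𝒟' : Literature.Geometry.Lorentzian.VacuumCauchyDevelopment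 (F c), 𝒟'.IsMaximal) ∧ ∀ 𝒟' : Literature.Geometry.Lorentzian.VacuumCauchyDevelopment (F c), 𝒟'.IsMaximal → Summit.FinalStateConjecture.HasCompleteNullInfinity 𝒟'.toCauchyDevelopment ∧ ∃ (O : Set 𝒟'.carrier) (d : Literature.Geometry.Lorentzian.FinalStateDecomposition 𝒟'.toSpacetime O 2), (∀ i, Literature.Geometry.Lorentzian.Kerr.IsSubextremal (d.mass i) (d.spin i)) ∧ O = Summit.FinalStateConjecture.exteriorOf 𝒟'.toCauchyDevelopment d.charted ∧ Summit.FinalStateConjecture.RaysStayInClosure 𝒟'.toCauchyDevelopment O ∧ Summit.FinalStateConjecture.HasExhaustiveCharts d ∧ Summit.FinalStateConjecture.IsFutureOriented d) := by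
  intro h₁ h₂ h₃ X _ _ _ _ _ _ D hD 𝒟 h𝒟 P hP hmodel hlonely
  -- S1: the rank-0 census — a nonflat smooth self-similar `C²` tangent profile at `P`
  obtain ⟨Z, hZ, hT⟩ := h₁ X D hD 𝒟 h𝒟 P hP hmodel hlonely
  -- S2: smooth-class profile instability — a tame immersed injective admissible curve through
  -- `D` whose small members are censored with an MGHD
  obtain ⟨e, F, hF, hI, hF0, hinj, hadm, ε, hε, hC⟩ := h₂ X D hD 𝒟 h𝒟 P hP Z hZ hT
  -- kernel: all members off `0` censored (same end, same base datum)
  obtain ⟨F₁, hF₁, hF₁0, hinj₁, hI₁, hadm₁, hC₁⟩ :=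
    InitialDataSet.exists_tameFamily_of_local (P := fun D' ↦
      (∃ 𝒟' : VacuumCauchyDevelopment D', 𝒟'.IsMaximal) ∧ ∀ 𝒟' : VacuumCauchyDevelopment D',
        𝒟'.IsMaximal → Summit.FinalStateConjecture.HasCompleteNullInfinity 𝒟'.toCauchyDevelopment)
      hF hI hinj hadm hε hC
  -- S3: basin landing along the censored curve, re-chosen through `D`
  obtain ⟨F₂, hF₂, hI₂, hF₂0, hinj₂, hadm₂, ε₂, hε₂, hG⟩ :=
    h₃ X D hD e F₁ hF₁ hI₁ (hF₁0.trans hF0) hinj₁ hadm₁ hC₁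
  exact ⟨e, F₂, hF₂, hI₂, hF₂0, hinj₂, hadm₂, ε₂, hε₂, hG⟩

/-- **THE SKELETON THEOREM: `LonelyTipTameExit` (the route decl, BY NAME) from the three
registered stubs** — `crux_body_of_stub_sigs` applied to `stub_selfSimilarCensusOfLonelyTips`,
`stub_profileCensoredExit`, `stub_settlingAlongCensoredCurves` (the only `sorry`s of the file live
inside those three stubs; this theorem's term is sorry-free and its type is literally the route
decl, which unfolds to the lemma's conclusion by `δ`). -/
theorem LonelyTipTameExit_of :
    Summit.FinalStateConjecture.FinalStateConjecture.Theses.NoVacuumStrings.LonelyTipTameExit :=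
  crux_body_of_stub_sigs stub_selfSimilarCensusOfLonelyTips stub_profileCensoredExit
    stub_settlingAlongCensoredCurves

end Summit.FinalStateConjecture.FinalStateConjecture.Cruxes.LonelyTipTameExit.Birth

end
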